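import Mathlib
import Literature.NumberTheory.Sieve.FriedlanderIwaniecPrimesThresholdSeparation
import Summits.Parity.GeneralizedHardyLittlewood.Theorems.FordMaynardSieveConst01651SieveConst01651TypeIICoeffs

/-!
# Route `FordMaynardSieveConst01651`, target `SieveConst01651` (stmt-Parity-19185), line `sieve_decomposition`:
# helpers towards `stub_typeIIRegion` — the `|w|`-mass of a bilinearly structured exceptional set via (II) and (w)

Companion of `…TypeIMass` (the (I)-version).  In Ford–Maynard's §7 (arXiv:2407.14368v1) an exceptional set of
integers `n = q n''` cut out by a condition `E(q, n'')` on the two factors (after the threshold / box conditions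
have been separated by Lemmas 7.9 / 7.13, i.e. by the tree's `BilinBoundedBy` transformers) is discarded by the
second half of (w), `|w_n| ≤ w_n + 2M` (Lemma 7.10), plus ONE bilinear bound with the trivial coefficients
`a = b = 1`.  At `P = (1/2, 0, ν)` this is how the non-squarefree members of `W ∖ (𝒫 ∪ 𝒩)` (a square `p² ∣ n` with
`p > n^ν`, which the printed `J ⊆ [k]` indexing of `H(n)` double-counts) are removed: `q = P⁻(n) ≤ x^ν` is in the
Type-II range `(1, x^ν]`, the coupling `q ≤ P⁻(n'')` is an integer threshold (`bilin_threshold_nat`), `p² ∣ n''` is a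
condition on `n''` alone.
* `bilin_sum_indicator_le` — a `BilinBoundedBy` bound `X` for the kernel `𝟙[E(q,n'')] K(q,n'')` controls the plain
  sum `|∑_{q ∈ W} ∑_{n'' ∈ Z, E} K(q, n'')| ≤ X` (coefficients `a = b = 1`);
* `bilin_abs_mass_le` — for real `w ≥ −M` (`M ≥ 0`): if `BilinBoundedBy (𝟙[E] · w(q n'')) W Z X` then
  `∑_{q ∈ W} ∑_{n'' ∈ Z, E(q,n'')} |w(q n'')| ≤ X + 2M · #{(q, n'') ∈ W × Z : E}`.
Def-free. Nothing here proves anything about the Parity summit.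
-/

open Finset Literature.NumberTheory.Sieve.FriedlanderIwaniecPrimes

namespace Summit.Parity.GeneralizedHardyLittlewood.FordMaynardSieveConst01651SieveConst01651

variable {ι κ : Type*}

/-- A `BilinBoundedBy` bound for the kernel `𝟙[E] K` bounds the plain restricted double sum (take `a = b = 1`).
[cite: FordMaynard2024PrimeSieves, §7.3 (use of (II) with trivial coefficients)] -/
theorem bilin_sum_indicator_le {K : ι → κ → ℂ} {W : Finset ι} {Z : Finset κ} {X : ℝ} (E : ι → κ → Prop)
    [∀ q n, Decidable (E q n)]
    (h : BilinBoundedBy (fun q n => (if E q n then (1 : ℂ) else 0) * K q n) W Z X) :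
    ‖∑ q ∈ W, ∑ n ∈ Z.filter (E q), K q n‖ ≤ X := by
  have h1 := h (fun _ => 1) (fun _ => 1) (fun _ => by simp) (fun _ => by simp)
  refine le_of_eq_of_le ?_ h1
  congr 1
  refine Finset.sum_congr rfl fun q _ => ?_
  rw [Finset.sum_filter]
  refine Finset.sum_congr rfl fun n _ => ?_
  by_cases hE : E q n <;> simp [hE]

/-- **`|w|`-mass of a bilinearly structured exceptional set via a bilinear bound and (w).** If `w ≥ −M` (`M ≥ 0`)
and every bilinear form in the kernel `𝟙[E(q, n'')] w(q n'')` over `W × Z` with `1`-bounded coefficients is `≤ X`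
(e.g. from (II) through `bilinBoundedBy_of_typeII_zero` and the separation transformers), then
`∑_{q ∈ W} ∑_{n'' ∈ Z, E(q, n'')} |w(q n'')| ≤ X + 2M · #{(q, n'') ∈ W × Z : E(q, n'')}`.
[cite: FordMaynard2024PrimeSieves, Lemma 7.10 (use of (w)) and §1 (II)] -/
theorem bilin_abs_mass_le {w : ℕ → ℝ} {M X : ℝ} {W Z : Finset ℕ} (E : ℕ → ℕ → Prop) [∀ q n, Decidable (E q n)]
    (hM : 0 ≤ M) (hw : ∀ n, -M ≤ w n)
    (h : BilinBoundedBy (fun q n => (if E q n then (1 : ℂ) else 0) * (w (q * n) : ℂ)) W Z X) :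
    ∑ q ∈ W, ∑ n ∈ Z.filter (E q), |w (q * n)| ≤
      X + 2 * M * (((W ×ˢ Z).filter (fun p => E p.1 p.2)).card : ℝ) := by
  -- `|w| ≤ w + 2M` termwise
  have step1 : ∑ q ∈ W, ∑ n ∈ Z.filter (E q), |w (q * n)| ≤
      ∑ q ∈ W, ∑ n ∈ Z.filter (E q), w (q * n) + 2 * M * (((W ×ˢ Z).filter (fun p => E p.1 p.2)).card : ℝ) := by
    have hnat : ((W ×ˢ Z).filter (fun p => E p.1 p.2)).card = ∑ q ∈ W, (Z.filter (E q)).card := by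
      rw [Finset.card_filter, Finset.sum_product]
      refine Finset.sum_congr rfl fun q _ => ?_
      rw [Finset.card_filter]
    have hcard : (((W ×ˢ Z).filter (fun p => E p.1 p.2)).card : ℝ) = ∑ q ∈ W, ((Z.filter (E q)).card : ℝ) := by
      rw [hnat]; push_cast; rfl
    rw [hcard, Finset.mul_sum, ← Finset.sum_add_distrib]
    refine Finset.sum_le_sum fun q _ => ?_
    exact sum_abs_le_sum_add hM (fun n _ => hw _)
  -- the `w`-sum is the bilinear form with `a = b = 1`
  have step2 : ∑ q ∈ W, ∑ n ∈ Z.filter (E q), w (q * n) ≤ X := by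
    have hb := bilin_sum_indicator_le E h
    have hre : ((∑ q ∈ W, ∑ n ∈ Z.filter (E q), w (q * n) : ℝ) : ℂ) =
        ∑ q ∈ W, ∑ n ∈ Z.filter (E q), (w (q * n) : ℂ) := by push_cast; rfl
    rw [← hre, Complex.norm_real] at hb
    exact (le_abs_self _).trans hb
  linarith

end Summit.Parity.GeneralizedHardyLittlewood.FordMaynardSieveConst01651SieveConst01651
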